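/-
Copyright (c) 2026 the pub-hodgecm-mathlib formalisation cell (harness21).  Prover seat hodgecm-mathlib-K2E3-p23 (g2): Track B «K2-LIT», engine E3, line (ii′)
«H-side central germ expansion» (line lead K2E4-p06 (g2)), leaf (E) `sig_K2E3CentralGermExpansionExistence`, brick (E3a) «RAO-EX_z»; 2026-09-04.
-/
import Literature.NumberTheory.Rogawski1990.UnitaryTwoOneCentralUnipotentStrataCM   -- ★ p855879 (E2b) (this seat): `cmDatum_local_one_mul_comm`, `fst_comm_of_mem_center`; brings the N = 2 dictionary ★ p855844
import Literature.NumberTheory.Automorphic.LocalOrbitalMeasureSemisimple            -- ★ `exists_orbitalMeasureFamily_of_isMulRightInvariant`, `isMulRightInvariant_subgroup_of_eq_top` (Deitmar–Echterhoff per class)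
import Literature.NumberTheory.Automorphic.LocalOrbitalMeasureRegular               -- ★ `modularCharacter_localEndoscopic_eq_one` (`H_v` unimodular)
import Literature.NumberTheory.Automorphic.LocalOrbitalMeasure                      -- ★ `isMulRightInvariant_of_forall_comm`, `isClosed_coe_centralizer_singleton`
import HarnessLib

/-!
# «RAO-EX_z»: invariant orbital measures EXIST at the classes of `H_v = U(Φ₂)(L⁺_v) × U(Φ₁)(L⁺_v)` over a central `z` (Ranga Rao 1972, existence half; Rogawski 1990
# §3.9 p. 32: `G_{n(t)} = Z·N` is abelian in rank one)

Topic `NumberTheory/Rogawski1990`; namespace `Literature.NumberTheory.Rogawski1990`.  THEOREMS ONLY (no definition, no instance, no notation, no named fact, no `sorry`);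
kernel lane `--supports stmt-HodgeConjecture-24833`.  Cell `pub/hodgecm-mathlib` (D-0151), crux H413 = `stmt-HodgeConjecture-24833`; Track B «K2-LIT», engine E3, tier-1 unit
`…Sigs_U3bCentralGerms`, line (ii′) (line lead K2E4-p06 (g2)), leaf **(E) `sig_K2E3CentralGermExpansionExistence`**, sub-leaf **(RAO_z) `sig_K2E3CentralUnipotentOrbitalMeasures`**
(cand 8d919bc037b0f39d), brick **(E3a) «RAO-EX_z»** of K2E3-p23 (g2)'s programme ((E1) ★ p855739 · (E2) ★ · (E4) ★ p855937 (K2E4-p21) · (E5) ★ p855945 + assembly p855998 · (E3)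
= «RAO-EX_z» (this file) + «RAO-CONV_z» (K2E5-p11 (g2), cand 35641b1af515a2eb)).
HONEST LABEL: HC_CM is proved only modulo the 7 printed citations (2 remaining named inputs: hLiu418 = stmt-HodgeConjecture-24832, h413 = stmt-HodgeConjecture-24833) until rung 0
closes; count-neutral brick.

THE MATHEMATICS.  `z = (z₁, z₂) ∈ Z(H_v)`, `γ` over `z` (`((γz⁻¹)₁ − 1)² = 0 ∧ (γz⁻¹)₂ = 1`).  `H_v` is unimodular (★ `modularCharacter_localEndoscopic_eq_one`), so by the tree's
per-class Deitmar–Echterhoff construction (★ `exists_orbitalMeasureFamily_of_isMulRightInvariant`) it suffices that every Haar measure on the centraliser `Z(γ)` is right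
invariant: for `γ = z`, `Z(z) = H_v` (★ `isMulRightInvariant_subgroup_of_eq_top`); for `γ ≠ z`, `Z(γ)` is ABELIAN (★ `isMulRightInvariant_of_forall_comm`) — `γ = (u·z₁, z₂)`
with `u` a non-trivial unipotent of `U(Φ₂)(L⁺_v)`, `z₁` central, `U(Φ₁)` commutative, and the centraliser of `u` in `U(Φ₂)(L⁺_v)` is commutative: in the one-place model
`ψ : U(Φ₂)(L⁺_v) ≃ U(σ_w, J₀)(L_w)` (★ `localNonsplitEquiv`), `ψ u ∼ n(t)`, `t ≠ 0` (★ `exists_conj_coe_eq_lineUnipotent`), and a `2 × 2` matrix commuting with `n(t)` is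
`(α, β; 0, α)` — such matrices commute pairwise ([Rogawski1990] §3.9: `G_{n(t)} = S·N`).

* §1 (field level) `apply_eq_of_mul_lineUnipotent_comm`, `mul_comm_of_mul_lineUnipotent_comm` (matrices commuting with `n(t)`, `t ≠ 0`, commute with each other);
* §2 `centralizer_mul_comm_of_centralUnipotent` (the centraliser in `H_v` of a `γ ≠ z` over `z` is commutative);
* §3 **`exists_orbitalMeasureFamily_isAdmissibleOn_centralUnipotent`** («RAO-EX_z»: an orbital-measure family on `H_v` ADMISSIBLE at every class over `z`).

## References
* [Rao1972] R. Ranga Rao, *Orbital integrals in reductive groups*, Ann. of Math. (2) 96 (1972) 505–510, Theorem (existence half).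
* [Rogawski1990] J. D. Rogawski, *Automorphic Representations of Unitary Groups in Three Variables*, Ann. of Math. Stud. 123 (1990): §3.9 p. 32 (`G_{n(t)} = S·N`), §1.10 p. 9,
  §4.9 p. 54, §8.1 p. 112.
* [DeitmarEchterhoff2014] A. Deitmar, S. Echterhoff, *Principles of Harmonic Analysis*, 2nd ed. (2014), Thm. 1.5.3 (invariant measures on quotients).
-/

set_option autoImplicit false

noncomputable section

open scoped Matrix MatrixGroups Classical
open MeasureTheory Measure NumberField IsDedekindDomain Matrix Set Topology

namespace Literature.NumberTheory.Rogawski1990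

open Literature.NumberTheory.Automorphic Literature.NumberTheory.Automorphic.UnitaryGroup Literature.NumberTheory.GaloisRepresentations
open Literature.NumberTheory.Automorphic.HermitianLattice Literature.MeasureTheory.Group

/-! ## §1 Field level: matrices commuting with `n(t) = (1, t; 0, 1)`, `t ≠ 0` -/

section Field

variable {K : Type*} [Field K]

/-- A `2 × 2` matrix commuting with `n(t)`, `t ≠ 0`, is upper triangular with equal diagonal entries. [cite: Rogawski1990, §3.9 p. 32] -/
theorem apply_eq_of_mul_lineUnipotent_comm {t : K} (ht : t ≠ 0) {M : Matrix (Fin 2) (Fin 2) K}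
    (h : M * !![1, t; 0, 1] = !![1, t; 0, 1] * M) : M 1 0 = 0 ∧ M 1 1 = M 0 0 := by
  rw [Matrix.eta_fin_two M] at h
  have e00 := congrArg (fun A : Matrix (Fin 2) (Fin 2) K => A 0 0) h
  have e01 := congrArg (fun A : Matrix (Fin 2) (Fin 2) K => A 0 1) h
  simp only [Matrix.mul_fin_two, Matrix.of_apply, Matrix.cons_val', Matrix.cons_val_zero, Matrix.cons_val_one, Matrix.empty_val', Matrix.cons_val_fin_one,
    one_mul, mul_one, zero_mul, mul_zero, add_zero, zero_add] at e00 e01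
  -- e00 : M 0 0 = M 0 0 + t * M 1 0 ;  e01 : M 0 0 * t + M 0 1 = M 0 1 + t * M 1 1
  have h10 : M 1 0 = 0 := by
    have h' : t * M 1 0 = 0 := by linear_combination -e00
    rcases mul_eq_zero.1 h' with h' | h'
    · exact absurd h' ht
    · exact h'
  have h11 : M 1 1 = M 0 0 := by
    have h' : t * (M 1 1 - M 0 0) = 0 := by linear_combination -e01
    rcases mul_eq_zero.1 h' with h' | h'
    · exact absurd h' ht
    · exact sub_eq_zero.1 h'
  exact ⟨h10, h11⟩

/-- **Two `2 × 2` matrices commuting with `n(t)`, `t ≠ 0`, commute with each other** (both are `(α, β; 0, α)`). [cite: Rogawski1990, §3.9 p. 32] -/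
theorem mul_comm_of_mul_lineUnipotent_comm {t : K} (ht : t ≠ 0) {M M' : Matrix (Fin 2) (Fin 2) K}
    (h : M * !![1, t; 0, 1] = !![1, t; 0, 1] * M) (h' : M' * !![1, t; 0, 1] = !![1, t; 0, 1] * M') : M * M' = M' * M := by
  obtain ⟨h10, h11⟩ := apply_eq_of_mul_lineUnipotent_comm ht h
  obtain ⟨h10', h11'⟩ := apply_eq_of_mul_lineUnipotent_comm ht h'
  rw [Matrix.eta_fin_two M, Matrix.eta_fin_two M', h10, h11, h10', h11']
  ext i j
  fin_cases i <;> fin_cases j <;> simp [Matrix.mul_apply, Fin.sum_univ_two] <;> ring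

end Field

/-! ## §2 The centraliser of a non-central element over `z` is commutative -/

section Central

variable (L : Type) [Field L] [NumberField L] [IsCMField L] (v : HeightOneSpectrum (𝓞 ↥(maximalRealSubfield L)))

set_option maxHeartbeats 1600000 in
-- one-place transport of three elements
/-- **For `z ∈ Z(H_v)` and `γ ≠ z` over `z`, the centraliser `Z(γ) ≤ H_v` is COMMUTATIVE** (one place `w ∣ v`): `γ = (u z₁, z₂)` with `u ≠ 1` unipotent; an element of `Z(γ)` has
first component in the centraliser of `u` (★ `fst_comm_of_mem_center`), which in the one-place model is conjugate into the matrices commuting with `n(t)`, `t ≠ 0` — an abelian set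
(§1); the second components lie in the commutative `U(Φ₁)(L⁺_v)`. [cite: Rogawski1990, §3.9 p. 32; §4.9 p. 54] -/
theorem centralizer_mul_comm_of_centralUnipotent (w : UnitaryGroup.PlacesOver L v) (hsub : Subsingleton (UnitaryGroup.PlacesOver L v))
    {z : (cmDatum L 2 (Matrix.of fun i j : Fin 2 => if i.val + j.val + 1 = 2 then (1 : L) else 0)).Local v × (cmDatum L 1 (Matrix.of fun i j : Fin 1 => if i.val + j.val + 1 = 1 then (1 : L) else 0)).Local v}
    (hz : z ∈ Subgroup.center ((cmDatum L 2 (Matrix.of fun i j : Fin 2 => if i.val + j.val + 1 = 2 then (1 : L) else 0)).Local v ×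
      (cmDatum L 1 (Matrix.of fun i j : Fin 1 => if i.val + j.val + 1 = 1 then (1 : L) else 0)).Local v))
    {γ : (cmDatum L 2 (Matrix.of fun i j : Fin 2 => if i.val + j.val + 1 = 2 then (1 : L) else 0)).Local v × (cmDatum L 1 (Matrix.of fun i j : Fin 1 => if i.val + j.val + 1 = 1 then (1 : L) else 0)).Local v}
    (hγ : ((((γ * z⁻¹).1).val : GL (Fin 2) (UnitaryGroup.LocalRing L v)).val - 1) ^ 2 = 0 ∧ (γ * z⁻¹).2 = 1) (hγz : γ ≠ z) :
    ∀ a ∈ Subgroup.centralizer ({γ} : Set ((cmDatum L 2 (Matrix.of fun i j : Fin 2 => if i.val + j.val + 1 = 2 then (1 : L) else 0)).Local v × (cmDatum L 1 (Matrix.of fun i j : Fin 1 => if i.val + j.val + 1 = 1 then (1 : L) else 0)).Local v)),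
      ∀ b ∈ Subgroup.centralizer ({γ} : Set ((cmDatum L 2 (Matrix.of fun i j : Fin 2 => if i.val + j.val + 1 = 2 then (1 : L) else 0)).Local v × (cmDatum L 1 (Matrix.of fun i j : Fin 1 => if i.val + j.val + 1 = 1 then (1 : L) else 0)).Local v)),
        a * b = b * a := by
  haveI : Algebra.IsQuadraticExtension ↥(maximalRealSubfield L) L := IsCMField.isQuadraticExtension L
  have hw : IsCMField.complexConj L • w.1 = w.1 := smul_placesOver_eq_of_subsingleton L v (IsCMField.complexConj L) hsub w
  have hσσ : ∀ x : w.1.adicCompletion L, galAdicCompletionMap (L := L) (IsCMField.complexConj L) hw (galAdicCompletionMap (L := L) (IsCMField.complexConj L) hw x) = x :=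
    galAdicCompletionMap_galAdicCompletionMap_of_smul_eq (IsCMField.complexConj L) w (IsCMField.complexConj_ne_one L) hw
  -- the unipotent `u := γ₁ z₁⁻¹ ≠ 1`
  have hu0 : (γ * z⁻¹).1 ≠ 1 := by
    intro h
    apply hγz
    have h1 : γ.1 = z.1 := by
      have h' : γ.1 * z.1⁻¹ = 1 := h
      exact mul_inv_eq_one.1 h'
    exact Prod.ext h1 (mul_inv_eq_one.1 hγ.2)
  -- the one-place model read in `GL₂(L_w)`
  obtain ⟨ψ, hψ⟩ : ∃ ψ : (cmDatum L 2 (Matrix.of fun i j : Fin 2 => if i.val + j.val + 1 = 2 then (1 : L) else 0)).Local v → GL (Fin 2) (w.1.adicCompletion L), ∀ y, ψ y =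
      ((localNonsplitEquiv (IsCMField.complexConj L) (Matrix.of fun i j : Fin 2 => if i.val + j.val + 1 = 2 then (1 : L) else 0) (IsCMField.complexConj_ne_one L) w hw y :
        ↥(unitaryGroupOfForm (galAdicCompletionMap (L := L) (IsCMField.complexConj L) hw)
          (placeForm (Matrix.of fun i j : Fin 2 => if i.val + j.val + 1 = 2 then (1 : L) else 0) w.1))) : GL (Fin 2) (w.1.adicCompletion L)) :=
    ⟨_, fun _ => rfl⟩
  have hψmul : ∀ y y', ψ (y * y') = ψ y * ψ y' := fun y y' => by
    rw [hψ, hψ, hψ]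
    exact congrArg Subtype.val (map_mul (localNonsplitEquiv (IsCMField.complexConj L) _ (IsCMField.complexConj_ne_one L) w hw) y y')
  have hψinj : ∀ y y', ψ y = ψ y' → y = y' := fun y y' h => by
    rw [hψ, hψ] at h
    exact (localNonsplitEquiv (IsCMField.complexConj L) _ (IsCMField.complexConj_ne_one L) w hw).injective (Subtype.ext h)
  have hψU : ∀ y, ψ y ∈ unitaryGroupOfForm (galAdicCompletionMap (L := L) (IsCMField.complexConj L) hw) ((StdForm.antidiagonal 2).over (w.1.adicCompletion L)) :=
    fun y => by rw [hψ]; exact coe_localNonsplitEquiv_two_mem L w hw y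
  have hψsq : (((ψ (γ * z⁻¹).1 : GL (Fin 2) (w.1.adicCompletion L)) : Matrix (Fin 2) (Fin 2) (w.1.adicCompletion L)) - 1) ^ 2 = 0 := by
    rw [hψ]; exact (sub_one_pow_eq_zero_iff_coe_localNonsplitEquiv_two L w hw hsub _ 2).1 hγ.1
  -- normal form `k (ψ u) k⁻¹ = n(t)`, `t ≠ 0`
  obtain ⟨k, -, t, -, hshape⟩ := exists_conj_coe_eq_lineUnipotent (galAdicCompletionMap (L := L) (IsCMField.complexConj L) hw) hσσ (hψU (γ * z⁻¹).1) ⟨2, hψsq⟩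
  have ht : t ≠ 0 := by
    intro ht0
    apply hu0
    have h1 : k * ψ (γ * z⁻¹).1 * k⁻¹ = 1 := Units.ext (by rw [hshape, ht0, Units.val_one]; ext i j; fin_cases i <;> fin_cases j <;> rfl)
    have h2 : ψ (γ * z⁻¹).1 = 1 := by
      calc ψ (γ * z⁻¹).1 = k⁻¹ * (k * ψ (γ * z⁻¹).1 * k⁻¹) * k := by group
        _ = 1 := by rw [h1]; group
    rw [hψ] at h2
    exact (coe_localNonsplitEquiv_two_eq_one_iff L w hw _).1 h2
  -- an element of `Z(γ)` has first component commuting with `u`, hence `k ψ(·) k⁻¹` commuting with `n(t)`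
  have hcomm : ∀ a : (cmDatum L 2 (Matrix.of fun i j : Fin 2 => if i.val + j.val + 1 = 2 then (1 : L) else 0)).Local v × (cmDatum L 1 (Matrix.of fun i j : Fin 1 => if i.val + j.val + 1 = 1 then (1 : L) else 0)).Local v,
      a ∈ Subgroup.centralizer ({γ} : Set ((cmDatum L 2 (Matrix.of fun i j : Fin 2 => if i.val + j.val + 1 = 2 then (1 : L) else 0)).Local v × (cmDatum L 1 (Matrix.of fun i j : Fin 1 => if i.val + j.val + 1 = 1 then (1 : L) else 0)).Local v)) →
      (((k * ψ a.1 * k⁻¹ : GL (Fin 2) (w.1.adicCompletion L)) : Matrix (Fin 2) (Fin 2) (w.1.adicCompletion L)) * !![1, t; 0, 1] =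
        !![1, t; 0, 1] * ((k * ψ a.1 * k⁻¹ : GL (Fin 2) (w.1.adicCompletion L)) : Matrix (Fin 2) (Fin 2) (w.1.adicCompletion L))) := by
    intro a ha
    have hγa : γ * a = a * γ := (Subgroup.mem_centralizer_iff.1 ha γ (Set.mem_singleton γ))
    have h1 : γ.1 * a.1 = a.1 * γ.1 := congrArg Prod.fst hγa
    -- `a₁` commutes with `u = γ₁ z₁⁻¹` (`z₁⁻¹` central)
    have hu : (γ * z⁻¹).1 * a.1 = a.1 * (γ * z⁻¹).1 := by
      show γ.1 * z.1⁻¹ * a.1 = a.1 * (γ.1 * z.1⁻¹)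
      rw [mul_assoc, ← (fst_comm_of_mem_center hz a.1).2, ← mul_assoc, h1, mul_assoc]
    have hU : ψ (γ * z⁻¹).1 * ψ a.1 = ψ a.1 * ψ (γ * z⁻¹).1 := by rw [← hψmul, ← hψmul, hu]
    -- conjugate by `k`
    have hk : (k * ψ (γ * z⁻¹).1 * k⁻¹) * (k * ψ a.1 * k⁻¹) = (k * ψ a.1 * k⁻¹) * (k * ψ (γ * z⁻¹).1 * k⁻¹) := by
      calc (k * ψ (γ * z⁻¹).1 * k⁻¹) * (k * ψ a.1 * k⁻¹) = k * (ψ (γ * z⁻¹).1 * ψ a.1) * k⁻¹ := by group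
        _ = k * (ψ a.1 * ψ (γ * z⁻¹).1) * k⁻¹ := by rw [hU]
        _ = (k * ψ a.1 * k⁻¹) * (k * ψ (γ * z⁻¹).1 * k⁻¹) := by group
    rw [← hshape, ← Units.val_mul, ← Units.val_mul]
    exact congrArg Units.val hk.symm
  intro a ha b hb
  -- first components commute
  have h1 : a.1 * b.1 = b.1 * a.1 := by
    apply hψinj
    rw [hψmul, hψmul]
    have hM := mul_comm_of_mul_lineUnipotent_comm ht (hcomm a ha) (hcomm b hb)
    have hM' : (k * ψ a.1 * k⁻¹) * (k * ψ b.1 * k⁻¹) = (k * ψ b.1 * k⁻¹) * (k * ψ a.1 * k⁻¹) :=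
      Units.ext (by simpa only [Units.val_mul] using hM)
    calc ψ a.1 * ψ b.1 = k⁻¹ * ((k * ψ a.1 * k⁻¹) * (k * ψ b.1 * k⁻¹)) * k := by group
      _ = k⁻¹ * ((k * ψ b.1 * k⁻¹) * (k * ψ a.1 * k⁻¹)) * k := by rw [hM']
      _ = ψ b.1 * ψ a.1 := by group
  -- second components commute (U(Φ₁) is commutative)
  exact Prod.ext h1 (cmDatum_local_one_mul_comm L v a.2 b.2)

/-! ## §3 «RAO-EX_z» -/

/-- **«RAO-EX_z» — INVARIANT ORBITAL MEASURES EXIST AT THE CLASSES OVER A CENTRAL `z`** (one place above `v`): an orbital-measure family `mU` on `H_v` ADMISSIBLE at every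
class whose representative lies over `z` (`((γ z⁻¹)₁ − 1)² = 0 ∧ (γ z⁻¹)₂ = 1`): non-zero, `H_v`-invariant, finite on compacta on `H_v ⧸ Z(γ)` — with regular members there.
`H_v` unimodular (★ `modularCharacter_localEndoscopic_eq_one`), the per-class construction ★ `exists_orbitalMeasureFamily_of_isMulRightInvariant`, the centraliser Haar measures
right invariant because `Z(z) = H_v` (★ `isMulRightInvariant_subgroup_of_eq_top`) and `Z(γ)` is commutative for `γ ≠ z` (§2, ★ `isMulRightInvariant_of_forall_comm`).  The
existence half of the sub-leaf (RAO_z) `sig_K2E3CentralUnipotentOrbitalMeasures`. [cite: Rao1972, Theorem] [cite: Rogawski1990, §3.9 p. 32; §4.9 p. 54; §8.1 p. 112]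
[cite: DeitmarEchterhoff2014, Thm. 1.5.3] -/
theorem exists_orbitalMeasureFamily_isAdmissibleOn_centralUnipotent (w : UnitaryGroup.PlacesOver L v) (hsub : Subsingleton (UnitaryGroup.PlacesOver L v))
    [MeasurableSpace ((cmDatum L 2 (Matrix.of fun i j : Fin 2 => if i.val + j.val + 1 = 2 then (1 : L) else 0)).Local v × (cmDatum L 1 (Matrix.of fun i j : Fin 1 => if i.val + j.val + 1 = 1 then (1 : L) else 0)).Local v)]
    [BorelSpace ((cmDatum L 2 (Matrix.of fun i j : Fin 2 => if i.val + j.val + 1 = 2 then (1 : L) else 0)).Local v × (cmDatum L 1 (Matrix.of fun i j : Fin 1 => if i.val + j.val + 1 = 1 then (1 : L) else 0)).Local v)]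
    [∀ a : (cmDatum L 2 (Matrix.of fun i j : Fin 2 => if i.val + j.val + 1 = 2 then (1 : L) else 0)).Local v × (cmDatum L 1 (Matrix.of fun i j : Fin 1 => if i.val + j.val + 1 = 1 then (1 : L) else 0)).Local v,
      MeasurableSpace (((cmDatum L 2 (Matrix.of fun i j : Fin 2 => if i.val + j.val + 1 = 2 then (1 : L) else 0)).Local v × (cmDatum L 1 (Matrix.of fun i j : Fin 1 => if i.val + j.val + 1 = 1 then (1 : L) else 0)).Local v) ⧸
        Subgroup.centralizer ({a} : Set ((cmDatum L 2 (Matrix.of fun i j : Fin 2 => if i.val + j.val + 1 = 2 then (1 : L) else 0)).Local v × (cmDatum L 1 (Matrix.of fun i j : Fin 1 => if i.val + j.val + 1 = 1 then (1 : L) else 0)).Local v)))]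
    [∀ a : (cmDatum L 2 (Matrix.of fun i j : Fin 2 => if i.val + j.val + 1 = 2 then (1 : L) else 0)).Local v × (cmDatum L 1 (Matrix.of fun i j : Fin 1 => if i.val + j.val + 1 = 1 then (1 : L) else 0)).Local v,
      BorelSpace (((cmDatum L 2 (Matrix.of fun i j : Fin 2 => if i.val + j.val + 1 = 2 then (1 : L) else 0)).Local v × (cmDatum L 1 (Matrix.of fun i j : Fin 1 => if i.val + j.val + 1 = 1 then (1 : L) else 0)).Local v) ⧸
        Subgroup.centralizer ({a} : Set ((cmDatum L 2 (Matrix.of fun i j : Fin 2 => if i.val + j.val + 1 = 2 then (1 : L) else 0)).Local v × (cmDatum L 1 (Matrix.of fun i j : Fin 1 => if i.val + j.val + 1 = 1 then (1 : L) else 0)).Local v)))]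
    {z : (cmDatum L 2 (Matrix.of fun i j : Fin 2 => if i.val + j.val + 1 = 2 then (1 : L) else 0)).Local v × (cmDatum L 1 (Matrix.of fun i j : Fin 1 => if i.val + j.val + 1 = 1 then (1 : L) else 0)).Local v}
    (hz : z ∈ Subgroup.center ((cmDatum L 2 (Matrix.of fun i j : Fin 2 => if i.val + j.val + 1 = 2 then (1 : L) else 0)).Local v ×
      (cmDatum L 1 (Matrix.of fun i j : Fin 1 => if i.val + j.val + 1 = 1 then (1 : L) else 0)).Local v)) :
    ∃ mU : OrbitalMeasureFamily ((cmDatum L 2 (Matrix.of fun i j : Fin 2 => if i.val + j.val + 1 = 2 then (1 : L) else 0)).Local v × (cmDatum L 1 (Matrix.of fun i j : Fin 1 => if i.val + j.val + 1 = 1 then (1 : L) else 0)).Local v),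
      mU.IsAdmissibleOn (fun γ : (cmDatum L 2 (Matrix.of fun i j : Fin 2 => if i.val + j.val + 1 = 2 then (1 : L) else 0)).Local v × (cmDatum L 1 (Matrix.of fun i j : Fin 1 => if i.val + j.val + 1 = 1 then (1 : L) else 0)).Local v =>
        ((((γ * z⁻¹).1).val : GL (Fin 2) (UnitaryGroup.LocalRing L v)).val - 1) ^ 2 = 0 ∧ (γ * z⁻¹).2 = 1) ∧
      ∀ c : ConjClasses ((cmDatum L 2 (Matrix.of fun i j : Fin 2 => if i.val + j.val + 1 = 2 then (1 : L) else 0)).Local v × (cmDatum L 1 (Matrix.of fun i j : Fin 1 => if i.val + j.val + 1 = 1 then (1 : L) else 0)).Local v),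
        (((((Quotient.out c * z⁻¹).1).val : GL (Fin 2) (UnitaryGroup.LocalRing L v)).val - 1) ^ 2 = 0 ∧ (Quotient.out c * z⁻¹).2 = 1) → (mU c).Regular := by
  have hG : ∀ g : (cmDatum L 2 (Matrix.of fun i j : Fin 2 => if i.val + j.val + 1 = 2 then (1 : L) else 0)).Local v × (cmDatum L 1 (Matrix.of fun i j : Fin 1 => if i.val + j.val + 1 = 1 then (1 : L) else 0)).Local v,
      modularCharacterFun g = 1 := fun g => modularCharacter_localEndoscopic_eq_one L v g
  have hzc : ∀ g : (cmDatum L 2 (Matrix.of fun i j : Fin 2 => if i.val + j.val + 1 = 2 then (1 : L) else 0)).Local v × (cmDatum L 1 (Matrix.of fun i j : Fin 1 => if i.val + j.val + 1 = 1 then (1 : L) else 0)).Local v,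
      g * z = z * g := fun g => Subgroup.mem_center_iff.1 hz g
  obtain ⟨m, hm⟩ := exists_orbitalMeasureFamily_of_isMulRightInvariant hG
    (fun γ : (cmDatum L 2 (Matrix.of fun i j : Fin 2 => if i.val + j.val + 1 = 2 then (1 : L) else 0)).Local v × (cmDatum L 1 (Matrix.of fun i j : Fin 1 => if i.val + j.val + 1 = 1 then (1 : L) else 0)).Local v =>
      ((((γ * z⁻¹).1).val : GL (Fin 2) (UnitaryGroup.LocalRing L v)).val - 1) ^ 2 = 0 ∧ (γ * z⁻¹).2 = 1)
    (fun γ hγ ρ _ => by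
      by_cases hγz : γ = z
      · subst hγz
        refine isMulRightInvariant_subgroup_of_eq_top _ ((Subgroup.eq_top_iff' _).2 fun g => ?_) hG ρ
        exact Subgroup.mem_centralizer_iff.2 (by rintro _ ⟨⟩; exact (hzc g).symm)
      · exact isMulRightInvariant_of_forall_comm _ (isClosed_coe_centralizer_singleton γ)
          (centralizer_mul_comm_of_centralUnipotent L v w hsub hz hγ hγz) ρ)
  exact ⟨m, fun c hc => ⟨(hm c hc).1, (hm c hc).2.1, (hm c hc).2.2.2⟩, fun c hc => (hm c hc).2.2.1⟩

end Central

end Literature.NumberTheory.Rogawski1990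

end
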